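import Mathlib.NumberTheory.NumberField.Basic
import Mathlib.NumberTheory.Padics.PadicNumbers
import Mathlib.Topology.Algebra.ContinuousMonoidHom
import Literature.NumberTheory.GaloisRepresentations.AbsGaloisGroup
import Literature.AlgebraicGeometry.Frobenioids.Categories
import Literature.AnabelianGeometry.AbsoluteAnabelian.FundamentalExtension
import Literature.AnabelianGeometry.AbsoluteAnabelian.ProfiniteTerminology
import Literature.AnabelianGeometry.AbsoluteAnabelian.AbsAnabFundamentalGroups

/-!
# [AbsTopI] §1 Def 1.1 (ii)(iii) and §2 (Prop 2.2, Prop 2.3, Thm 2.6, Thm 2.14): semi-absolute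
# anabelian geometry — the IUT-cited items

S. Mochizuki, *Topics in Absolute Anabelian Geometry I: Generalities* (2012) [AbsTopI], manuscript
pagination (lit key paper:url-11ac98ba15fc, 83 pp.).  §2 "Semi-absolute Anabelian Geometry"
(pp. 16–34) characterises "group-theoretically" the quotient `Π ↠ G` of the arithmetic fundamental
group of a variety onto the Galois group of its base field (Def 2.1: extensions "of AFG-type" /
"of GSAFG-type" `1 → Δ → Π → G → 1` with their "scheme-theoretic envelopes" and "construction
data" `(k, X, Y ↪ Ȳ, Σ)`).  The items [IUTchI–III] cite — Prop 2.2, Prop 2.3, Thm 2.6, Thm 2.14 —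
are typed over abc-iut-L4-t1's interface `FundamentalExtension` (`arith = Π`, `gal = G`,
`geom = Δ`) and the base-field data `NFBase` / `MLFBase` of `AbsAnabFundamentalGroups.lean`:

* group-theoretic VOCABULARY as real definitions: `IsElastic`, `IsVeryElastic` (Def 1.1 (ii)),
  `IsProSet`, `IsAlmostPro Σ`, `IsAlmostProOmissive` (Def 1.1 (iii)); the invariants
  `δ¹_l = freeProlRank`, `ζ` (`zetaInv`) of Thm 2.6; and the character vocabulary of §4 Lemma 4.5
  (ii) quoted by [AbsTopIII] Rmk 1.5.1: `IsQuasiTrivial`, `IsCyclotomicallyFull`,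
  `IsQCyclotomicOfWeight`, `PowerEquivalent`; `IsFreeProOn`/`IsFreePro` (free pro-`Σ` of finite rank,
  Lemma 4.5 (i));
* the printed CONCLUSIONS as predicates on abstract data (what a hypothesis "`E` is of
  AFG-type with construction data field an MLF / NF and base-stack a hyperbolic orbicurve" lists):
  `GeomTFG` (Prop 2.2), `GeomSlimElastic` / `ArithSlimNotElastic` (Prop 2.3 (i),(ii)),
  `Thm26…` (Thm 2.6 (i),(ii),(iv),(v),(vi)), `Thm214GroupPart` (Thm 2.14 (i), group part);
* CLOSED named facts (`def … : Prop`) where the printed assertion holds for ALL abstract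
  extensions with the stated base field: `thm26_vi_maximal` (Δ is the maximal topologically
  finitely generated closed normal subgroup when `G = G_F`, a formal consequence of [AbsAnab]
  Thm 1.1.2), `thm26_vi_not_tfg` (`Π` is not topologically finitely generated when `G = G_F`),
  `thm26_ii_delta_gal` (`δ¹_l(G_k) = 1` for `l ≠ p`, `δ¹_p(G_k) = [k : ℚ_p] + 1` — local class field
  theory);
* PROVED: the "not elastic" half of Prop 2.3 (ii) (`not_isElastic_of_geom`).

Deliberately NOT here: Def 2.1 itself (it quantifies over schemes/log schemes — the "arises
from" hypothesis that the campaign's `π₁^{ét}` construction will supply; FOUNDATIONS row 12),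
Def 2.4/Prop 2.5/Cor 2.8–2.12 (not cited), Thm 2.6 (iii) and the `H²`-invariants `δ²_l`, `θ²`
(continuous cohomology with `ℚ_l`-coefficients is not available; consequently Thm 2.6 (v) is
typed in the case `Θ = {1}`, which is the case `Σ = Primes` used throughout [IUTchI–III] — see the
TODO at `Thm26v`), the semi-graph part of Thm 2.14 (typed over abc-iut-L3's semi-graph interface
in a later file), §3 (not cited), §4 (separate file `AbsTopIChains.lean`).
-/

noncomputable section

open Topology
open scoped Pointwise

universe u

namespace Literature.AnabelianGeometry.AbsoluteAnabelian

open Field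
open Literature.AlgebraicGeometry.Frobenioids (IsSlimGroup)

/-! ### [AbsTopI] Def 1.1 (ii), (iii): elastic, almost pro-Σ, almost pro-omissive -/

section Vocabulary

variable (G : Type u) [Group G] [TopologicalSpace G] [IsTopologicalGroup G]

/-- [AbsTopI] Def 1.1 (ii): `G` is *elastic* if "every topologically finitely generated closed
normal subgroup `N ⊆ H` of an open subgroup `H ⊆ G` of `G` is either trivial or of finite index
in `G`". [cite: MochizukiAbsTopI2012, Def 1.1 (ii) p.10] -/
@[mk_iff] structure IsElastic : Prop where
  /-- tfg closed normal subgroups of open subgroups are trivial or of finite index -/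
  eq_bot_or_finiteIndex : ∀ (H N : Subgroup G), IsOpen (H : Set G) → N ≤ H →
    (N.subgroupOf H).Normal → IsClosed (N : Set G) → IsTopologicallyFinitelyGenerated N →
    N = ⊥ ∨ N.FiniteIndex

/-- [AbsTopI] Def 1.1 (ii): `G` is *very elastic* if it is elastic but not topologically finitely
generated. [cite: MochizukiAbsTopI2012, Def 1.1 (ii) p.10] -/
@[mk_iff] structure IsVeryElastic : Prop where
  /-- elastic -/
  isElastic : IsElastic G
  /-- not topologically finitely generated -/
  not_tfg : ¬ IsTopologicallyFinitelyGenerated G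

/-- A topological group is *pro-`Σ`* (for a set of primes `Σ`) if the index of every open normal
subgroup is a product of primes of `Σ` ([AbsTopI] §0/Def 1.1 (iii) usage; for a profinite group
this says every finite quotient is a `Σ`-group). [cite: MochizukiAbsTopI2012, Def 1.1 (iii) p.10] -/
@[mk_iff] structure IsProSet (S : Set ℕ) : Prop where
  /-- prime divisors of indices of open normal subgroups lie in `Σ` -/
  prime_dvd_index : ∀ (U : Subgroup G), U.Normal → IsOpen (U : Set G) →
    ∀ q : ℕ, q.Prime → q ∣ U.index → q ∈ S

/-- [AbsTopI] Def 1.1 (iii): `G` is *almost pro-`Σ`* if it "admits an open subgroup which is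
pro-`Σ`". [cite: MochizukiAbsTopI2012, Def 1.1 (iii) p.10] -/
@[mk_iff] structure IsAlmostPro (S : Set ℕ) : Prop where
  /-- some open subgroup is pro-`Σ` -/
  exists_open_pro : ∃ H : Subgroup G, IsOpen (H : Set G) ∧ IsProSet H S

/-- [AbsTopI] Def 1.1 (iii): `G` is *pro-omissive* if it is pro-`(≠ p)` := pro-`(Primes ∖ {p})`
for some prime `p`, and *almost pro-omissive* if it admits a pro-omissive open subgroup.
[cite: MochizukiAbsTopI2012, Def 1.1 (iii) p.10] -/
@[mk_iff] structure IsAlmostProOmissive : Prop where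
  /-- some open subgroup is pro-prime-to-`p` for some prime `p` -/
  exists_open_proOmissive : ∃ (p : ℕ) (H : Subgroup G), p.Prime ∧ IsOpen (H : Set G) ∧
    IsProSet H {q | q.Prime ∧ q ≠ p}

/-- The invariant `ζ(H) := sup_{p, p' ∈ Primes} {δ¹_p(H) − δ¹_{p'}(H)} ∈ ℤ ∪ {∞}` of [AbsTopI]
Thm 2.6 (defined in print "whenever `δ¹_l(H) < ∞` for all `l`"), typed in `ℕ∞` with
`δ¹_l = freeProlRank` (truncated subtraction; the supremum of the differences is `≥ 0` as
`p = p'` is allowed). [cite: MochizukiAbsTopI2012, Thm 2.6 p.21] -/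
def zetaInv : ℕ∞ :=
  ⨆ (p : Nat.Primes) (p' : Nat.Primes),
    @freeProlRank G _ _ p.1 ⟨p.2⟩ - @freeProlRank G _ _ p'.1 ⟨p'.2⟩

/-- [AbsTopI] Lemma 4.5 (ii): a continuous action of `G` on a finite-dimensional `ℚ_l`-vector
space is *quasi-trivial* if "it factors through a finite quotient of `G`" — some open subgroup of
finite index acts trivially ([CombGC] Def 2.3 (i)). Typed for a representation by linear
automorphisms. [cite: MochizukiAbsTopI2012, Lemma 4.5 (ii) p.54] -/
@[mk_iff] structure IsQuasiTrivial {l : ℕ} [Fact l.Prime] {M : Type*} [AddCommGroup M]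
    [Module ℚ_[l] M] (ρ : G →* (M ≃ₗ[ℚ_[l]] M)) : Prop where
  /-- an open subgroup of finite index acts trivially -/
  exists_open_trivial : ∃ U : Subgroup G, IsOpen (U : Set G) ∧ U.FiniteIndex ∧ ∀ g ∈ U, ρ g = 1

/-- [AbsTopI] Lemma 4.5 / [CombGC] Def 2.3 (ii): "the outer action of `G` on `Δ` is
`l`-cyclotomically full", i.e. the cyclotomic character `χ : G → ℤ_l^×` "has open image"
(quoted by [AbsTopIII] Rmk 1.5.1). [cite: MochizukiAbsTopI2012, Lemma 4.5 p.54] -/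
@[mk_iff] structure IsCyclotomicallyFull {l : ℕ} [Fact l.Prime] (χ : G →* ℤ_[l]ˣ) : Prop where
  /-- the image of `χ` is open in `ℤ_l^×` -/
  isOpen_range : IsOpen (Set.range χ)

/-- [AbsTopI] Lemma 4.5 (preamble, from [Mzk12] Def 2.3 (i),(ii)): a character `χ : G → ℤ_l^×` is
*`ℚ`-cyclotomic of weight `w ∈ ℚ`* (relative to the cyclotomic character `χ^{cyclo}`) "if there
exist integers `a, b`, where `b > 0`, such that `χ^b = (χ^{cyclo})^a`, `w = 2a/b`".
[cite: MochizukiAbsTopI2012, Lemma 4.5 p.54] -/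
def IsQCyclotomicOfWeight {l : ℕ} [Fact l.Prime] (χcyclo χ : G →* ℤ_[l]ˣ) (w : ℚ) : Prop :=
  ∃ a b : ℤ, 0 < b ∧ (∀ g : G, χ g ^ b = χcyclo g ^ a) ∧ w = 2 * a / b

/-- [AbsTopI] Lemma 4.5 (ii): "two characters `G → ℤ_l^×` are power-equivalent if there exists a
positive integer `n` such that the `n`-th powers of the two characters coincide" (quoted by
[AbsTopIII] Rmk 1.5.1). [cite: MochizukiAbsTopI2012, Lemma 4.5 (ii) p.54] -/
def PowerEquivalent {l : ℕ} [Fact l.Prime] (χ₁ χ₂ : G →* ℤ_[l]ˣ) : Prop :=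
  ∃ n : ℕ, 0 < n ∧ ∀ g : G, χ₁ g ^ n = χ₂ g ^ n

/-- A topological group `H` is *free pro-`Σ` of finite rank* on the family `gens : Fin n → H`
("free pro-`Σ`", [AbsTopI] Lemma 4.5 (i); [Mzk12] Rmk 1.1.3): `H` is itself pro-`Σ` AND every map
of the generators into a finite `Σ`-group `K` (all prime divisors of `|K|` in `Σ`; discrete
topology) extends uniquely to a continuous homomorphism — the universal property of the pro-`Σ`
completion of the free group.  (The pro-`Σ` conjunct is necessary: the extension property alone is
also satisfied by `F̂_Σ(n) × ℤ_q`, `q ∉ Σ`, since continuous homomorphisms to finite `Σ`-groups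
kill `ℤ_q` — referee abc-iut-ref-f, PASS-F3 F19.) [cite: MochizukiAbsTopI2012, Lemma 4.5 (i) p.54] -/
def IsFreeProOn (S : Set ℕ) {n : ℕ} (gens : Fin n → G) : Prop :=
  IsProSet G S ∧
    ∀ (K : Type) [Group K] [Finite K] [TopologicalSpace K] [DiscreteTopology K],
      (∀ q : ℕ, q.Prime → q ∣ Nat.card K → q ∈ S) →
        ∀ f : Fin n → K, ∃! φ : G →* K, Continuous φ ∧ ∀ i, φ (gens i) = f i

/-- `H` is a free pro-`Σ` group of some finite rank (pro-`Σ` with the universal property on some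
finite family). [cite: MochizukiAbsTopI2012, Lemma 4.5 (i) p.54] -/
def IsFreePro (S : Set ℕ) : Prop := ∃ (n : ℕ) (gens : Fin n → G), IsFreeProOn G S gens

end Vocabulary

namespace FundamentalExtension

variable (E : FundamentalExtension.{u})

/-! ### [AbsTopI] Prop 2.2, Prop 2.3 -/

/-- [AbsTopI] Prop 2.2 (Topological finite generation) as a predicate on an extension: "Any
profinite group `Δ` of GFG-type is topologically finitely generated" — here for `Δ = geom E`.
[cite: MochizukiAbsTopI2012, Prop 2.2 p.18] -/
def GeomTFG : Prop := IsTopologicallyFinitelyGenerated E.geom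

/-- [AbsTopI] Prop 2.3 (i) as a predicate: `Δ` "is slim and elastic" (print: for `Δ` of GFG-type
with base-stack a hyperbolic orbicurve and `Σ` containing a prime invertible in `k`).
[cite: MochizukiAbsTopI2012, Prop 2.3 (i) p.19] -/
def GeomSlimElastic : Prop := IsSlimGroup E.geom ∧ IsElastic E.geom

/-- [AbsTopI] Prop 2.3 (ii) as a predicate: `Π` "is slim, but not elastic" (print: for
`1 → Δ → Π → G → 1` of GSAFG-type with base-stack a hyperbolic orbicurve, `Σ ≠ ∅`, and `k` an MLF
or an NF).  [IUTchI] p. 39 cites the slimness half.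
[cite: MochizukiAbsTopI2012, Prop 2.3 (ii) p.19] -/
def ArithSlimNotElastic : Prop := IsSlimGroup E.arith ∧ ¬ IsElastic E.arith

/-- [AbsTopI] Prop 2.3 (ii), the "not elastic" half of its proof, PROVED for abstract
extensions: "the fact that `Π` is not elastic follows from the existence of the nontrivial,
topologically finitely generated, closed, normal, infinite index subgroup `Δ ⊆ Π`".
[cite: MochizukiAbsTopI2012, Prop 2.3 (ii) p.19] -/
theorem not_isElastic_of_geom (hne : E.geom ≠ ⊥) (htfg : IsTopologicallyFinitelyGenerated E.geom)
    (hinf : ¬ E.geom.FiniteIndex) : ¬ IsElastic E.arith := by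
  intro h
  have h1 : Subgroup.normalizer (E.geom : Set E.arith) = ⊤ := Subgroup.normalizer_eq_top E.geom
  have hnorm : (E.geom.subgroupOf ⊤).Normal := by
    refine (Subgroup.normal_subgroupOf_iff_le_normalizer le_top).mpr ?_
    simp [h1]
  rcases h.eq_bot_or_finiteIndex ⊤ E.geom isOpen_univ le_top hnorm E.isClosed_geom htfg with
    h1 | h2
  · exact hne h1
  · exact hinf h2

/-! ### [AbsTopI] Thm 2.6 (Field types and group-theoreticity) -/

/-- [AbsTopI] Thm 2.6 (i) (`k` an FF), group-theoretic core as a predicate: "`Π` is topologically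
finitely generated", "the kernel of the quotient `Π ↠ G` may be characterized as the kernel of the
quotient `Π ↠ Π^{ab-t}`" — typed as: `Δ` is the intersection of the kernels of all continuous
homomorphisms `Π → ℤ_l` (all primes `l`; torsion-free profinite abelian groups embed into
products of `ℤ_l`'s) — and "`δ¹_l(H) = 1`" for every open `H` and every `l`.  (Print also: the
natural surjections `Π^{ab-t} ↠ G^{ab-t}`, `G ↠ G^{ab-t}` are isomorphisms.)
[cite: MochizukiAbsTopI2012, Thm 2.6 (i) p.21] -/
def Thm26i : Prop :=
  IsTopologicallyFinitelyGenerated E.arith ∧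
    (E.geom = ⨅ (l : ℕ) (_ : Fact l.Prime) (φ : E.arith →ₜ* Multiplicative ℤ_[l]),
      φ.toMonoidHom.ker) ∧
    ∀ (H : Subgroup E.arith), IsOpen (H : Set E.arith) → ∀ (l : ℕ) [Fact l.Prime],
      freeProlRank H l = 1

/-- [AbsTopI] Thm 2.6 (ii) (`k` an MLF of residue characteristic `p`, construction data prime set
`Σ`), as a predicate: "`Π` is topologically finitely generated"; "`δ¹_l(G) = 1` if `l ≠ p`,
`δ¹_p(G) = [k : ℚ_p] + 1`"; "the quantity `δ¹_l(Π) − δ¹_l(G)` is `= 0` if `l ∉ Σ`, and is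
independent of `l` if `l ∈ Σ`"; "`ε¹_p(Π) = ∞`" (the `δ¹_p` of open subgroups of `Π` are
unbounded). [cite: MochizukiAbsTopI2012, Thm 2.6 (ii) p.21] -/
def Thm26ii (B : E.MLFBase) (S : Set ℕ) : Prop :=
  IsTopologicallyFinitelyGenerated E.arith ∧
    (∀ (l : ℕ) [Fact l.Prime], l ≠ B.p → freeProlRank E.gal l = 1) ∧
    @freeProlRank E.gal _ _ B.p B.instPrime = (Module.finrank ℚ_[B.p] B.K + 1 : ℕ) ∧
    (∀ (l : ℕ) [Fact l.Prime], l ∉ S → freeProlRank E.arith l = freeProlRank E.gal l) ∧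
    (∀ (l₁ l₂ : ℕ) [Fact l₁.Prime] [Fact l₂.Prime], l₁ ∈ S → l₂ ∈ S →
      freeProlRank E.arith l₁ - freeProlRank E.gal l₁ =
        freeProlRank E.arith l₂ - freeProlRank E.gal l₂) ∧
    ∀ n : ℕ, ∃ H : Subgroup E.arith, IsOpen (H : Set E.arith) ∧
      (n : ℕ∞) ≤ @freeProlRank H _ _ B.p B.instPrime

/-- [AbsTopI] Thm 2.6 (ii), the part that is a statement about `G_k` ALONE ("the well-known
fact", proof p. 23, "cf. our discussion of local class field theory"): for `k` a finite extension
of `ℚ_p`, `δ¹_l(G_k) = 1` for `l ≠ p` and `δ¹_p(G_k) = [k : ℚ_p] + 1`; here `δ¹_l` is the free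
pro-`l` rank of `ProfiniteTerminology.lean`.  A closed named fact (local class field theory).
[cite: MochizukiAbsTopI2012, Thm 2.6 (ii) p.21] -/
def thm26_ii_delta_gal : Prop :=
  ∀ (p : ℕ) [Fact p.Prime] (K : Type) [Field K] [Algebra ℚ_[p] K] [FiniteDimensional ℚ_[p] K],
    (∀ (l : ℕ) [Fact l.Prime], l ≠ p → freeProlRank (absoluteGaloisGroup K) l = 1) ∧
      freeProlRank (absoluteGaloisGroup K) p = (Module.finrank ℚ_[p] K + 1 : ℕ)

/-- [AbsTopI] Thm 2.6 (iv) (`k` an MLF) as a predicate: "every almost pro-omissive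
topologically finitely generated closed normal subgroup of `Π` is contained in `Δ`.  If,
moreover, `Σ ≠ Primes`, then the kernel of the quotient `Π ↠ G` may be characterized
["group-theoretically"] as the maximal almost pro-omissive topologically finitely generated
closed normal subgroup of `Π`." [cite: MochizukiAbsTopI2012, Thm 2.6 (iv) p.22] -/
def Thm26iv (S : Set ℕ) : Prop :=
  (∀ N : Subgroup E.arith, N.Normal → IsClosed (N : Set E.arith) →
      IsTopologicallyFinitelyGenerated N → IsAlmostProOmissive N → N ≤ E.geom) ∧
    (S ≠ {q | q.Prime} → IsAlmostProOmissive E.geom ∧ IsTopologicallyFinitelyGenerated E.geom)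

/-- [AbsTopI] Thm 2.6 (v) (`k` an MLF), in the case `Θ = {1}` — the case `θ²(Π) = Primes`, e.g.
`Σ = Primes`, which is the situation of [IUTchI–III] — as a predicate:
"`ζ̃(Π) := ζ(Π/Θ) = [k : ℚ_p]`.  In particular, the kernel of the quotient `Π ↠ G` may be
characterized ["group-theoretically"] as the intersection of the open subgroups `H ⊆ Π` such
that `ζ̃(H)/ζ̃(Π) = [Π : H]`."  [IUTchI] pp. 39, 107 and [IUTchII] p. 67 cite (v)/(vi) as "the
subgroup `Δ ⊆ Π` may be reconstructed group-theoretically".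
TODO(general form): the subgroup `Θ` (maximal almost pro-omissive tfg closed normal subgroup
when `θ²(Π) ≠ Primes`), which needs the `H²`-invariant `δ²_l`.
[cite: MochizukiAbsTopI2012, Thm 2.6 (v) p.22] -/
def Thm26v (B : E.MLFBase) : Prop :=
  zetaInv E.arith = (Module.finrank ℚ_[B.p] B.K : ℕ) ∧
    E.geom = ⨅ (H : Subgroup E.arith) (_ : IsOpen (H : Set E.arith))
      (_ : zetaInv H = (H.index : ℕ∞) * zetaInv E.arith), H

/-- [AbsTopI] Thm 2.6 (vi) (`k` an NF) as a predicate: "the natural surjection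
`Π^{ab-t} ↠ G^{ab-t}` is an isomorphism" — typed as: every continuous homomorphism `Π → ℤ_l`
kills `Δ` —, "the kernel of the quotient `Π ↠ G` may be characterized ["group-theoretically"] as
the maximal topologically finitely generated closed normal subgroup of `Π`.  In particular,
`Π` is not topologically finitely generated." [cite: MochizukiAbsTopI2012, Thm 2.6 (vi) p.22] -/
def Thm26vi : Prop :=
  (∀ (l : ℕ) [Fact l.Prime] (φ : E.arith →ₜ* Multiplicative ℤ_[l]), E.geom ≤ φ.toMonoidHom.ker) ∧
    E.GeomIsMaxTFGNormalIn ⊤ ∧ ¬ IsTopologicallyFinitelyGenerated E.arith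

/-- [AbsTopI] Thm 2.6 (vi), DERIVED FORM (not the printed theorem, whose hypothesis "extension of
AFG-type or GSAFG-type with construction data field an NF" is geometric): for ALL abstract extensions with
`G ≅ G_F`, `F` a number field, and `Δ` topologically finitely generated (which Prop 2.2 gives in the
printed setting), `Δ` is the maximal topologically finitely generated closed normal subgroup of
`Π` — a formal consequence of [AbsAnab] Thm 1.1.2 (= [FJ] 15.10), exactly as in [AbsAnab]
Lemma 1.1.4 (i).  Closed named fact. [cite: MochizukiAbsTopI2012, Thm 2.6 (vi) p.22] -/
def thm26_vi_maximal : Prop :=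
  ∀ (E : FundamentalExtension.{0}) (_B : E.NFBase), IsTopologicallyFinitelyGenerated E.geom →
    E.GeomIsMaxTFGNormalIn ⊤

/-- [AbsTopI] Thm 2.6 (vi) "In particular, `Π` is not topologically finitely generated", DERIVED
FORM valid for ALL abstract extensions with `G ≅ G_F`, `F` a number field: `G_F` is a quotient of
`Π` and is itself not topologically finitely generated (it is very elastic, [AbsTopI] Thm 1.7 (iii)
p. 14), and quotients of topologically finitely generated groups are such.  Closed named fact.
[cite: MochizukiAbsTopI2012, Thm 2.6 (vi) p.22] -/
def thm26_vi_not_tfg : Prop :=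
  ∀ (E : FundamentalExtension.{0}) (_B : E.NFBase), ¬ IsTopologicallyFinitelyGenerated E.arith

/-! ### [AbsTopI] Thm 2.14 (Graph-theoreticity for hyperbolic curves), group part -/

variable {E} {F : FundamentalExtension.{u}}

/-- [AbsTopI] Thm 2.14 (i), group-theoretic part, as a predicate on an isomorphism `φ : Π₁ ≅ Π₂`
between extensions with MLF base data: "`p₁ = p₂`, `Σ₁ = Σ₂`; `φ` induces isomorphisms
`Δ₁ ≅ Δ₂`, `G₁ ≅ G₂`" — with `Σᵢ` read, as in the proof (p. 33: "`Σᵢ` is the unique minimal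
`Σ ⊆ Primes` such that `Δᵢ` is almost pro-`Σ`"), as the minimal almost-pro set of `Δᵢ`, so that
"`Σ₁ = Σ₂`" says the two extensions have the same minimal sets (print: `kᵢ` an MLF of residue
characteristic `pᵢ`, `Σᵢ ∋` a prime `≠ pᵢ`, `Xᵢ` a hyperbolic curve with stable reduction; the
isomorphism of dual semi-graphs `Γ₁ ≅ Γ₂` and (ii) are typed over abc-iut-L3's semi-graph
interface in `AbsTopIGraphTheoreticity.lean`). [cite: MochizukiAbsTopI2012, Thm 2.14 (i) p.33] -/
def Thm214GroupPart (B₁ : E.MLFBase) (B₂ : F.MLFBase) (φ : E.arith ≃ₜ* F.arith) : Prop :=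
  B₁.p = B₂.p ∧ PreservesGeom φ ∧
    ∀ S : Set ℕ, (IsAlmostPro E.geom S ∧ ∀ S', IsAlmostPro E.geom S' → S ⊆ S') ↔
      (IsAlmostPro F.geom S ∧ ∀ S', IsAlmostPro F.geom S' → S ⊆ S')

end FundamentalExtension

end Literature.AnabelianGeometry.AbsoluteAnabelian
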